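import Mathlib
import HarnessLib

/-!
# OscillatoryJacobi

Topic `Literature/Uncategorized`. Named literature fact(s) relocated by the gate from `Summits/FinalStateConjecture/FinalStateConjecture/Theorems/StarvedNecksNeckGapDecayStubOscillatoryJacobi.lean`
(accept-time relocation of `[cite]`d propositions written inline in a Summits proposal; human ruling 2026-08-15).

* `Literature.Uncategorized.OscillatoryJacobi` — PROVED; topical home of statement and proof:
  `Literature/Analysis/ODE/OscillatoryJacobi.lean` (`Literature.Analysis.ODE.oscillatoryJacobi_bound`,
  librarian refactor wi-38735); discharge record `OscillatoryJacobi_holds` in `OscillatoryJacobiProofs.lean`.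
  New consumers should import the `Analysis/ODE` file and use the theorem, not this name.
-/

namespace Literature.Uncategorized

open Set

/-- **M1 — oscillatory Jacobi lemma** (the scalar shadow of the lever; card "First lemma"): a Jacobi field `J`
driven by a tidal potential that is an EXACT second derivative, `J″ = −a″J` on `[0,1]` with `|a′| ≤ δ ≤ 1`, stays
`100·δ·(|J 0| + |J′ 0|)`-close to the free motion `J 0 + s·(J′ 0 + a′ 0·J 0)`, with NO hypothesis on `a″`
(`K := J′ + a′J` obeys `K′ = a′(K − a′J)`; Grönwall on `(J, K)`). PROVED: verbatim the theorem
`Literature.Analysis.ODE.oscillatoryJacobi_bound` (`Literature/Analysis/ODE/OscillatoryJacobi.lean`); discharge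
record `OscillatoryJacobi_holds`. [folklore] -/
def OscillatoryJacobi : Prop :=
  ∀ (a J : ℝ → ℝ) (δ : ℝ), δ ∈ Icc (0 : ℝ) 1 → ContDiff ℝ 2 a → ContDiff ℝ 2 J →
    (∀ s ∈ Icc (0 : ℝ) 1, |deriv a s| ≤ δ) →
    (∀ s ∈ Icc (0 : ℝ) 1, iteratedDeriv 2 J s = -(iteratedDeriv 2 a s) * J s) →
    ∀ s ∈ Icc (0 : ℝ) 1, |J s - (J 0 + s * (deriv J 0 + deriv a 0 * J 0))| ≤ 100 * δ * (|J 0| + |deriv J 0|)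

end Literature.Uncategorized
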